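import Summits.CriticalPhenomena.PercolationContinuityZ3.Theorems.Transplant.SkelPhiRootChainN
import Summits.CriticalPhenomena.PercolationContinuityZ3.Theorems.Transplant.SkelPhiNegReachRoomsRun
import Summits.CriticalPhenomena.PercolationContinuityZ3.Theorems.Transplant.TwoAxisParaCellsFineFrame
import HarnessLib

/-!
# N1 (the `{±1}` node), (R) column (N1-R-PLAN v2 §4 (R4d), part a; NEG-SCOPE B.14): THE FOOTPRINT READINGS OF THE ROOT CHAIN, PARAMETRIC —
# the footprint box **`Skelφ.FootBox lo∥ hi∥ w⊥ du z`** (`lo∥ ≤ sg_du·z_∥ ≤ hi∥`, `|z_⊥| ≤ w⊥`; `RootFoot`/`TargetFoot` of SkelPhiRootChainN are its instances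
# `rootFoot_iff`, `targetFoot_iff`) and its three sources: a planar box `z ∈ Icc LO HI` (`footBox_of_mem_Icc`, sign-split), coordinate bounds `|z i| ≤ k_i`
# (`footBox_of_abs_le` — near the root: `fineSkel t = 0` and `fine_containment`), and a RUN BOX of p1-g11's frame `runX φ c₀ n h 1` through p5-g8's readings
# (`footBox_of_runX_mem_Icc` = `fine_mem_Icc_of_runX_mem_Icc_signed` + `footBox_of_mem_Icc`); (F) reuses them with its own three numbers (hp-8 g33 16:5xZ (b))

builds on p205010 (kernel theorem, internal audit signed; external expert review pending) — nothing in this file uses p205010; nothing here is a claim about the open node.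
Lane `prim-bschramm`, seat `prim-bschramm-p3` (gen 9; design owner + (R) owner); helper file (`--supports stmt-CriticalPhenomena-4575 --as helper`).
[cite: KozmaNitzan2024, §4 p. 26 (Q_v, M_v, E_{v,x}), Lemma 12 (pp. 23–25)] [cite: MartineauTassion2017, §4.1]
-/

noncomputable section

namespace Summit.CriticalPhenomena.PercolationContinuityZ3.Theorems

namespace Transplant

namespace Skelφ

open Literature.Probability.Percolation Literature.Probability.LatticeModels SimpleGraph
open Literature.Probability.Percolation.KozmaNitzan.Cells (oth sgOf sgOf_sign)
open TwoAxis.Para (modulus coarse)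

variable {V : Type} {G : SimpleGraph V} {φ : V → Site 2}

/-! ## §1 The footprint box -/

/-- **The footprint box** of direction `du` with signed along-range `[lo∥, hi∥]` and transverse half-width `w⊥`. [cite: KozmaNitzan2024, §4 p. 26] -/
def FootBox (lopar hipar wperp : ℤ) (du : MDir) (z : Site 2) : Prop :=
  lopar ≤ sgOf du * z du.1 ∧ sgOf du * z du.1 ≤ hipar ∧ |z (oth du.1)| ≤ wperp

/-- `RootFoot` is the footprint box `(−5r∥ + 1, 25r∥ − 1, 5r⊥ − 2)`. [folklore] -/
theorem rootFoot_iff (P : PCells2) (du : MDir) (z : Site 2) :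
    RootFoot P du z ↔ FootBox (-(5 * (P.r du.1 : ℤ)) + 1) (25 * (P.r du.1 : ℤ) - 1) (5 * (P.r (oth du.1) : ℤ) - 2) du z := Iff.rfl

/-- `TargetFoot` is the footprint box `(17r∥ + 1, 23r∥ − 1, 3r⊥ − 1)`. [folklore] -/
theorem targetFoot_iff (P : PCells2) (du : MDir) (z : Site 2) :
    TargetFoot P du z ↔ FootBox (17 * (P.r du.1 : ℤ) + 1) (23 * (P.r du.1 : ℤ) - 1) (3 * (P.r (oth du.1) : ℤ) - 1) du z := by
  unfold TargetFoot FootBox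
  rw [abs_le]
  constructor
  · rintro ⟨⟨h1, h2⟩, h3⟩; exact ⟨by linarith, by linarith, h3⟩
  · rintro ⟨h1, h2, h3⟩; exact ⟨⟨by linarith, by linarith⟩, h3⟩

/-- Footprint boxes are monotone in the three numbers. [folklore] -/
theorem FootBox.mono {lopar hipar wperp lopar' hipar' wperp' : ℤ} {du : MDir} {z : Site 2} (h : FootBox lopar hipar wperp du z) (h₁ : lopar' ≤ lopar)
    (h₂ : hipar ≤ hipar') (h₃ : wperp ≤ wperp') : FootBox lopar' hipar' wperp' du z :=
  ⟨h₁.trans h.1, h.2.1.trans h₂, h.2.2.trans h₃⟩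

/-! ## §2 The three sources -/

/-- **From a planar box** `z ∈ Icc LO HI` (sign-split along `du`). [folklore] -/
theorem footBox_of_mem_Icc {lopar hipar wperp : ℤ} {du : MDir} {z LO HI : Site 2} (hz : z ∈ Finset.Icc LO HI)
    (h₁ : sgOf du = 1 → lopar ≤ LO du.1 ∧ HI du.1 ≤ hipar) (h₂ : sgOf du = -1 → lopar ≤ -HI du.1 ∧ -LO du.1 ≤ hipar)
    (h₃ : -wperp ≤ LO (oth du.1) ∧ HI (oth du.1) ≤ wperp) : FootBox lopar hipar wperp du z := by
  rw [Finset.mem_Icc, Pi.le_def, Pi.le_def] at hz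
  have ha := hz.1 du.1; have hb := hz.2 du.1; have hc := hz.1 (oth du.1); have hd := hz.2 (oth du.1)
  refine ⟨?_, ?_, abs_le.2 ⟨by linarith [h₃.1], by linarith [h₃.2]⟩⟩
  · rcases sgOf_sign du with hs | hs <;> rw [hs]
    · obtain ⟨hl, hu⟩ := h₁ hs; linarith
    · obtain ⟨hl, hu⟩ := h₂ hs; linarith
  · rcases sgOf_sign du with hs | hs <;> rw [hs]
    · obtain ⟨hl, hu⟩ := h₁ hs; linarith
    · obtain ⟨hl, hu⟩ := h₂ hs; linarith

/-- **From coordinate bounds** `|z ∥| ≤ k∥`, `|z ⊥| ≤ k⊥` (footprints near the root). [folklore] -/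
theorem footBox_of_abs_le {lopar hipar wperp kpar kperp : ℤ} {du : MDir} {z : Site 2} (hpar : |z du.1| ≤ kpar) (hperp : |z (oth du.1)| ≤ kperp)
    (h₁ : lopar ≤ -kpar) (h₂ : kpar ≤ hipar) (h₃ : kperp ≤ wperp) : FootBox lopar hipar wperp du z := by
  have hs : |sgOf du * z du.1| ≤ kpar := by
    rw [abs_mul, show |sgOf du| = 1 by rcases sgOf_sign du with h | h <;> simp [h], one_mul]; exact hpar
  rw [abs_le] at hs
  exact ⟨by linarith [hs.1], by linarith [hs.2], hperp.trans h₃⟩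

/-- **The fine skeleton vanishes at its base vertex** (rounding offsets `D/2`). [folklore] -/
theorem fineSkel_self (t : V) (A n h vα vβ c₀ c₁ : ℤ) {D : ℤ} (hD : 0 < D) : fineSkel φ t A n h vα vβ c₀ c₁ (D / 2) (D / 2) D t = 0 := by
  have h0 : relφ φ t t = 0 := by funext i; simp [relφ]
  funext i
  fin_cases i
  · show fineSkel φ t A n h vα vβ c₀ c₁ (D / 2) (D / 2) D t 0 = 0
    rw [fineSkel_apply_zero, h0, show TwoAxis.Para.lam0 A vα vβ 0 = 0 by simp [TwoAxis.Para.lam0]]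
    exact FinePrm.coarse_zero hD
  · show fineSkel φ t A n h vα vβ c₀ c₁ (D / 2) (D / 2) D t 1 = 0
    rw [fineSkel_apply_one, h0, show TwoAxis.Para.lam1 A n h 0 = 0 by simp [TwoAxis.Para.lam1, TwoAxis.Para.bp]]
    exact FinePrm.coarse_zero hD

/-- **Footprints near the root**: a vertex `w` with `|φ w i − φ t i| ≤ s` (`i = 0, 1`) has `|fineSkel w 0| ≤ k₀`, `|fineSkel w 1| ≤ k₁` under the fine-containment
inequalities `c₀·|A|(|vβ|+|vα|)·s ≤ k₀·D`, `c₁·|A|(|n|+|h|)·s ≤ k₁·D` (offsets `D/2`). [cite: KozmaNitzan2024, §4 Lemma 10 Step IV] -/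
theorem abs_fineSkel_le_of_near (t : V) {A n h vα vβ c₀ c₁ D s k₀ k₁ : ℤ} (hD : 0 < D) (hc₀ : 0 ≤ c₀) (hc₁ : 0 ≤ c₁)
    (hL0 : c₀ * (|A| * (|vβ| + |vα|) * s) ≤ k₀ * D) (hL1 : c₁ * (|A| * (|n| + |h|) * s) ≤ k₁ * D)
    {w : V} (h0 : |φ w 0 - φ t 0| ≤ s) (h1 : |φ w 1 - φ t 1| ≤ s) :
    |fineSkel φ t A n h vα vβ c₀ c₁ (D / 2) (D / 2) D w 0| ≤ k₀ ∧ |fineSkel φ t A n h vα vβ c₀ c₁ (D / 2) (D / 2) D w 1| ≤ k₁ := by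
  have hfc := fine_containment (φ := φ) t (s₀ := D / 2) (s₁ := D / 2) hD hc₀ hc₁ hL0 hL1 h0 h1
  have ht := fineSkel_self (φ := φ) t A n h vα vβ c₀ c₁ hD
  rw [ht] at hfc
  simpa using hfc

/-- **From a run box** of the frame `runX φ c₀ n h 1`: p5-g8's readings `fine_mem_Icc_of_runX_mem_Icc_signed` into a planar box `[LO, HI]`, then
`footBox_of_mem_Icc`. [cite: KozmaNitzan2024, §4 Lemma 12 (pp. 23–25)] -/
theorem footBox_of_runX_mem_Icc (t₀ : V) {A : ℤ} (hA : 0 ≤ A) {n : ℕ} (hn : 1 ≤ n) {h vα vβ : ℤ} (hm : 0 ≤ modulus n h vα vβ)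
    {c₀' c₁' s₀ s₁ D : ℤ} (hc₀ : 0 ≤ c₀') (hc₁ : 0 ≤ c₁') (hD : 0 < D) (c₀ : V) {lo hi LO HI : Site 2}
    (hLO0 : LO 0 ≤ fineSkel φ t₀ A n h vα vβ c₀' c₁' s₀ s₁ D c₀ 0 +
      (c₀' * (A * (modulus n h vα vβ * lo 0 - max (vα * ((shearUnit n h : ℤ) * lo 1)) (vα * ((shearUnit n h : ℤ) * hi 1 + shearUnit n h - 1))) / n)) / D)
    (hHI0 : fineSkel φ t₀ A n h vα vβ c₀' c₁' s₀ s₁ D c₀ 0 +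
      (c₀' * (A * (modulus n h vα vβ * hi 0 - min (vα * ((shearUnit n h : ℤ) * lo 1)) (vα * ((shearUnit n h : ℤ) * hi 1 + shearUnit n h - 1))) / n)) / D
        + 1 ≤ HI 0)
    (hLO1 : LO 1 ≤ fineSkel φ t₀ A n h vα vβ c₀' c₁' s₀ s₁ D c₀ 1 + (c₁' * (A * ((shearUnit n h : ℤ) * lo 1))) / D)
    (hHI1 : fineSkel φ t₀ A n h vα vβ c₀' c₁' s₀ s₁ D c₀ 1 + (c₁' * (A * ((shearUnit n h : ℤ) * hi 1 + shearUnit n h - 1))) / D + 1 ≤ HI 1)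
    {lopar hipar wperp : ℤ} {du : MDir}
    (h₁ : sgOf du = 1 → lopar ≤ LO du.1 ∧ HI du.1 ≤ hipar) (h₂ : sgOf du = -1 → lopar ≤ -HI du.1 ∧ -LO du.1 ≤ hipar)
    (h₃ : -wperp ≤ LO (oth du.1) ∧ HI (oth du.1) ≤ wperp)
    {v : V} (hv : runX φ c₀ n h 1 v ∈ Finset.Icc lo hi) :
    FootBox lopar hipar wperp du (fineSkel φ t₀ A n h vα vβ c₀' c₁' s₀ s₁ D v) :=
  footBox_of_mem_Icc (fine_mem_Icc_of_runX_mem_Icc_signed t₀ hA hn hm hc₀ hc₁ hD c₀ hLO0 hHI0 hLO1 hHI1 hv) h₁ h₂ h₃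

end Skelφ

end Transplant

end Summit.CriticalPhenomena.PercolationContinuityZ3.Theorems

end
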